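import Summits.HodgeConjecture.CorCM.OcticWeilOrbitRealisers
import Summits.HodgeConjecture.CorCM.OcticWeilFourfoldTwoTransitiveOfSimple
import Literature.AlgebraicGeometry.ComplexMultiplication.CMTypeConjugateIsogeny
import HarnessLib

/-!
# COR-CM — the Hodge conjecture for every product of copies of the GALOIS CONJUGATES of a SIMPLE CM fourfold of WEIL
# TYPE and the CM elliptic curve of `k`, GIVEN ONLY Markman's fourfold theorem: the INTRINSIC and GEOMETRIC forms

Cell `pub-hodgecm2` (COR-CM), seat b30 gen 20 (2026-08-22); count-neutral own lane OCTIC-WEIL-ORBIT — capstone of the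
lineage `Census/OcticWeilOrbit(Parts)` (kernel census) → `CorCM/OcticWeilOrbitFrameTransfer` → `…WeilParts` →
`…PowersHodgeOfMarkman` (frame form) → `…Realisers` (`A₄ ⊆` realised permutations under `2`-transitivity).  Theorems only; no
definition, no `sorry`; the ONE named fact stays DISPLAYED: `Markman2025_weilClasses_algebraic_abelianFourfold` (unrefereed).

THE STATEMENT (`hodgeConjectureFor_biproduct_comp_vec_of_isSimple_of_markman₃`).  `K` ANY CM field of degree `8`, `k`
imaginary quadratic with `i : k → K`, `τ : k → ℂ`; `B₁ ⊨ (K; Φ₁)`, `B₂ ⊨ (K; Φ₂)`, `B₃ ⊨ (K; Φ₃)` CM abelian fourfolds (realisations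
on `H¹`) whose types have `k`-signature `(2,2)` (`#{s ∈ Φ_m | s ∘ i = τ} = 2`) and are in GENERAL POSITION
(`#{s ∈ Φ_m ∩ Φ_{m'} | s ∘ i = τ} = 1` for `m ≠ m'` — equivalently: pairwise neither equal nor complex conjugate); `B₁` SIMPLE;
`E ⊨ (k; Ψ)` with `τ ∈ Ψ`.  Then for every `κ : Fin N → Fin 4` every rational `(q,q)`-class on `⨁_j ![E, B₁, B₂, B₃] (κ j)` —
`E^a × B₁^{n₁} × B₂^{n₂} × B₃^{n₃}`, all exponents, any order — is algebraic, and so is every Hodge class on anything dominated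
by such a product.  WHY THIS IS THE WHOLE GALOIS ORBIT: for `B₁` simple, Dodson's theorem (`Gal(Kᶜ/ℚ) ≅ ℤ₂ × A₄` or
`ℤ₂ × S₄`) makes `Aut(ℂ)` transitive on the SIX `(2,2)`-types of `(K, i, τ)`; three of them in general position together with
their conjugates are all six, and `σB₁ ⊨ (K; σΦ₁)`, `(B, ι ∘ c) ⊨ (K; Φ̄)` — so every product of Galois conjugates of `B₁`
(and of `E`) is a product of copies of `E, B₁, B₂, B₃` up to the choice of CM structures.

THE PROOF.  `exists_frame₃`: an enumeration `e : Hom(K, ℂ) ≃ Fin 4 × Bool` with `(e s).2 = [s ∘ i = τ]`, `e s̄ = ((e s).1,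
¬(e s).2)` in which each `Φ_m` reads as `Φ_{I_{m-1}}` or its conjugate (`I_m = {0, m+1}`; a finite relabeling lemma on `Fin 4`,
`decide`); `exists_realisation_of_reading`: a conjugate reading is absorbed by passing to the conjugate CM structure
`(B, ι ∘ 𝓞(c), θ ∘ c) ⊨ Φ̄` (tree: `IsCMTypeRealisation.comp_complexConj`, Deligne 1982 §5 (b)); gen 19's
`h2t_of_twoTransitive` and `twoTransitive_of_isSimple` (Dodson §3.3.2 BY NAME); and the frame form under `2`-transitivity
`hodgeConjectureFor_biproduct_comp_of_frame₃_of_markman_h2t` at the family `Kf = (k, K)`.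
HONEST FRAMING: conditional on the displayed Markman binder (arXiv:2509.23403, unrefereed); nothing here asserts `HC_CM`.

## References
* [Markman2025SurveySecant] E. Markman, arXiv:2509.23403 (2025), Thm. 1.2 and §1.1.  [Dodson1984] B. Dodson, Trans. AMS
  283 (1984), §3.3.2 Theorem.  [Deligne1982HodgeCycles] P. Deligne, LNM 900 (1982), §4 Prop. 4.4, §5 (b).
  [Shimura1998] G. Shimura, *Abelian varieties with complex multiplication and modular functions*, §8.2 Prop. 26, §18.2.
  [Pohlmann1968] H. Pohlmann, Ann. of Math. 88 (1968), Thm 1, §3.  [MoonenZarhin1995Duke] Duke Math. J. 77 (1995), Thm. 2.4.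
  [MumfordAV1970] D. Mumford, *Abelian Varieties*, §19.
-/

noncomputable section

open CategoryTheory CategoryTheory.Limits NumberField

namespace Summit.HodgeConjecture.CorCM.OcticWeilOrbit

open Literature.AlgebraicGeometry Literature.AlgebraicGeometry.Motives Literature.AlgebraicGeometry.HodgeTheory
open Literature.AlgebraicGeometry.ComplexMultiplication (IsCMTypeRealisation exists_conjugate_cmType)
open Literature.AlgebraicGeometry.Pohlmann1968
open Literature.AlgebraicTopology.SingularHomology
open Literature.NumberTheory.ComplexMultiplication
open Summit.HodgeConjecture.CorCM.Census.OcticWeilOrbit (signTab)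
open Summit.HodgeConjecture.CorCM.OcticWeilFourfold (exists_frame₂ h2t_of_twoTransitive twoTransitive_of_isSimple)

open scoped Classical

/-! ## §1 The frame for three `(2,2)`-types in general position -/

section Frame

/-- **The relabeling lemma** (finite, `decide`): three `2`-subsets `T₀, T₁, T₂` of `Fin 4` meeting pairwise in one point
form a star `{c,x}, {c,y}, {c,z}` or a triangle; in either case a permutation `σ` and flips `f_m` put `T_m` (or its complement,
if `f_m`) onto `I_m = {0, m+1}`: `a ∈ T_m ⟺ [σ a ∈ I_m] = ¬f_m`. [folklore] -/
theorem exists_perm_flips_of_pairs : ∀ T₀ T₁ T₂ : Finset (Fin 4), T₀.card = 2 → T₁.card = 2 → T₂.card = 2 →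
    (T₀ ∩ T₁).card = 1 → (T₀ ∩ T₂).card = 1 → (T₁ ∩ T₂).card = 1 →
    ∃ σ : Equiv.Perm (Fin 4), ∃ f : Fin 3 → Bool, ∀ a : Fin 4,
      (a ∈ T₀ ↔ signTab 0 0 (σ a) = !f 0) ∧ (a ∈ T₁ ↔ signTab 0 1 (σ a) = !f 1) ∧ (a ∈ T₂ ↔ signTab 0 2 (σ a) = !f 2) := by
  unfold signTab
  decide +kernel

variable {K : Type} [Field K] [NumberField K] [IsCMField K] {k : Type} [Field k] [NumberField k]

omit [NumberField K] [IsCMField K] [NumberField k] in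
/-- Counting through a frame over `τ`: `#{a < 4 | P(e⁻¹(a, true))} = #{s | s ∘ i = τ ∧ P s}`. [folklore] -/
theorem card_filter_symm_true [Fintype (K →+* ℂ)] {e : (K →+* ℂ) ≃ Fin 4 × Bool} {i : k →+* K} {τ : k →+* ℂ}
    (he_sign : ∀ s, (e s).2 = true ↔ s.comp i = τ) (P : (K →+* ℂ) → Prop)
    [DecidablePred fun a : Fin 4 => P (e.symm (a, true))] [DecidablePred fun s : K →+* ℂ => s.comp i = τ ∧ P s] :
    (Finset.univ.filter fun a : Fin 4 => P (e.symm (a, true))).card =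
      (Finset.univ.filter fun s : K →+* ℂ => s.comp i = τ ∧ P s).card := by
  refine Finset.card_bij (fun a _ => e.symm (a, true)) (fun a ha => ?_) (fun a _ b _ h => ?_) fun s hs => ?_
  · exact Finset.mem_filter.2 ⟨Finset.mem_univ _, (he_sign _).1 (by rw [Equiv.apply_symm_apply]),
      (Finset.mem_filter.1 ha).2⟩
  · exact (Prod.mk.inj (e.symm.injective h)).1
  · obtain ⟨-, hsτ, hP⟩ := Finset.mem_filter.1 hs
    have hs' : e.symm ((e s).1, true) = s := by
      rw [show ((e s).1, true) = e s from Prod.ext rfl ((he_sign s).2 hsτ).symm, Equiv.symm_apply_apply]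
    exact ⟨(e s).1, Finset.mem_filter.2 ⟨Finset.mem_univ _, by rw [hs']; exact hP⟩, hs'⟩

omit [NumberField K] [IsCMField K] in
/-- **Reading a CM type through a frame from its trace on the pairs.**  If `e s̄ = ((e s).1, ¬(e s).2)` and the members of
`Φ` over `τ` are known on the labels — `e⁻¹(a, true) ∈ Φ ⟺ [a ∈ I_m] = ¬f` — then for EVERY embedding
`s ∈ Φ ⟺ [(e s).1 ∈ I_m] = ((e s).2 ≠ f)` (over `τ̄` use `s ∈ Φ ⟺ s̄ ∉ Φ`). [cite: Shimura1998, §18.2 Lemma] -/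
theorem mem_iff_of_reading_true {e : (K →+* ℂ) ≃ Fin 4 × Bool}
    (he_conj : ∀ s, e (ComplexEmbedding.conjugate s) = ((e s).1, !(e s).2)) {Φ : CMType K} {m : Fin 3} {f : Bool}
    (hm : ∀ a : Fin 4, e.symm (a, true) ∈ Φ.1 ↔ signTab 0 m a = !f) (s : K →+* ℂ) :
    s ∈ Φ.1 ↔ signTab 0 m (e s).1 = ((e s).2 != f) := by
  have key := hm (e s).1
  cases h2s : (e s).2
  · -- `s` lies over `τ̄`: read its conjugate, which is `e⁻¹((e s).1, true)`
    have hs : ComplexEmbedding.conjugate s = e.symm ((e s).1, true) := by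
      apply e.injective
      rw [he_conj, Equiv.apply_symm_apply, h2s]
      rfl
    rw [← hs] at key
    rw [Φ.2 s, key]
    cases signTab 0 m (e s).1 <;> cases f <;> decide
  · have hs : s = e.symm ((e s).1, true) := by
      apply e.injective
      rw [Equiv.apply_symm_apply]
      exact Prod.ext rfl h2s
    rw [← hs] at key
    rw [key]
    cases signTab 0 m (e s).1 <;> cases f <;> decide

omit [IsCMField K] in
/-- **THE FRAME EXISTS.**  For `[K:ℚ] = 8`, `i : k → K`, `Hom(k, ℂ) = {τ, τ̄}` and three CM types `Φ₁, Φ₂, Φ₃` of `K` with two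
members over `τ` each and pairwise exactly one common member over `τ` (general position), there are an enumeration
`e : Hom(K, ℂ) ≃ Fin 4 × Bool` with `(e s).2 = [s ∘ i = τ]`, `e s̄ = ((e s).1, ¬(e s).2)` and flips `f : Fin 3 → Bool` such
that `Φ_{m+1}` READS as `Φ_{I_m}` (`f m = false`) or as its conjugate `Φ̄_{I_m}` (`f m = true`):
`s ∈ Φ_{m+1} ⟺ [(e s).1 ∈ I_m] = ((e s).2 ≠ f m)`.  (Any frame of gen 19's `exists_frame₂`, re-numbered on the pairs by the
relabeling lemma.) [cite: Shimura1998, §18.2 Lemma] [cite: Dodson1984, §3.1.1] -/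
theorem exists_frame₃ (h8 : Module.finrank ℚ K = 8) (h2 : Module.finrank ℚ k = 2) (i : k →+* K) {τ : k →+* ℂ}
    (hττ : ComplexEmbedding.conjugate τ ≠ τ) (hk : ∀ σ : k →+* ℂ, σ = τ ∨ σ = ComplexEmbedding.conjugate τ)
    (Φ₁ Φ₂ Φ₃ : CMType K)
    (h22₁ : (Finset.univ.filter fun s : K →+* ℂ => s.comp i = τ ∧ s ∈ Φ₁.1).card = 2)
    (h22₂ : (Finset.univ.filter fun s : K →+* ℂ => s.comp i = τ ∧ s ∈ Φ₂.1).card = 2)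
    (h22₃ : (Finset.univ.filter fun s : K →+* ℂ => s.comp i = τ ∧ s ∈ Φ₃.1).card = 2)
    (h₁₂ : (Finset.univ.filter fun s : K →+* ℂ => s.comp i = τ ∧ (s ∈ Φ₁.1 ∧ s ∈ Φ₂.1)).card = 1)
    (h₁₃ : (Finset.univ.filter fun s : K →+* ℂ => s.comp i = τ ∧ (s ∈ Φ₁.1 ∧ s ∈ Φ₃.1)).card = 1)
    (h₂₃ : (Finset.univ.filter fun s : K →+* ℂ => s.comp i = τ ∧ (s ∈ Φ₂.1 ∧ s ∈ Φ₃.1)).card = 1) :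
    ∃ (e : (K →+* ℂ) ≃ Fin 4 × Bool) (f : Fin 3 → Bool), (∀ s, (e s).2 = true ↔ s.comp i = τ) ∧
      (∀ s, e (ComplexEmbedding.conjugate s) = ((e s).1, !(e s).2)) ∧
      (∀ s, s ∈ Φ₁.1 ↔ signTab 0 0 (e s).1 = ((e s).2 != f 0)) ∧
      (∀ s, s ∈ Φ₂.1 ↔ signTab 0 1 (e s).1 = ((e s).2 != f 1)) ∧
      (∀ s, s ∈ Φ₃.1 ↔ signTab 0 2 (e s).1 = ((e s).2 != f 2)) := by
  -- any frame over `(k, i, τ)`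
  obtain ⟨e₀, he₀_sign, he₀_conj, -⟩ := exists_frame₂ h8 h2 i hττ hk Φ₁ h22₁
  -- the three `2`-subsets of the pairs, and the relabeling
  set T₀ : Finset (Fin 4) := Finset.univ.filter fun a => e₀.symm (a, true) ∈ Φ₁.1 with hT₀
  set T₁ : Finset (Fin 4) := Finset.univ.filter fun a => e₀.symm (a, true) ∈ Φ₂.1 with hT₁
  set T₂ : Finset (Fin 4) := Finset.univ.filter fun a => e₀.symm (a, true) ∈ Φ₃.1 with hT₂
  have hinter : ∀ (Φ Φ' : CMType K),
      (Finset.univ.filter fun a : Fin 4 => e₀.symm (a, true) ∈ Φ.1) ∩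
        (Finset.univ.filter fun a : Fin 4 => e₀.symm (a, true) ∈ Φ'.1) =
      Finset.univ.filter fun a : Fin 4 => e₀.symm (a, true) ∈ Φ.1 ∧ e₀.symm (a, true) ∈ Φ'.1 :=
    fun Φ Φ' => (Finset.filter_and _ _ _).symm
  obtain ⟨σ, f, hσ⟩ := exists_perm_flips_of_pairs T₀ T₁ T₂
    (by rw [hT₀, card_filter_symm_true he₀_sign (fun s => s ∈ Φ₁.1)]; exact h22₁)
    (by rw [hT₁, card_filter_symm_true he₀_sign (fun s => s ∈ Φ₂.1)]; exact h22₂)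
    (by rw [hT₂, card_filter_symm_true he₀_sign (fun s => s ∈ Φ₃.1)]; exact h22₃)
    (by rw [hT₀, hT₁, hinter, card_filter_symm_true he₀_sign (fun s => s ∈ Φ₁.1 ∧ s ∈ Φ₂.1)]; exact h₁₂)
    (by rw [hT₀, hT₂, hinter, card_filter_symm_true he₀_sign (fun s => s ∈ Φ₁.1 ∧ s ∈ Φ₃.1)]; exact h₁₃)
    (by rw [hT₁, hT₂, hinter, card_filter_symm_true he₀_sign (fun s => s ∈ Φ₂.1 ∧ s ∈ Φ₃.1)]; exact h₂₃)
  -- the re-numbered frame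
  let e : (K →+* ℂ) ≃ Fin 4 × Bool := e₀.trans (Equiv.prodCongr σ (Equiv.refl Bool))
  have he : ∀ s, e s = (σ (e₀ s).1, (e₀ s).2) := fun s => rfl
  have he_conj : ∀ s, e (ComplexEmbedding.conjugate s) = ((e s).1, !(e s).2) := fun s => by rw [he, he, he₀_conj]
  have hsymm : ∀ b : Fin 4, e.symm (b, true) = e₀.symm (σ.symm b, true) := fun b => rfl
  -- reading a type through the re-numbered frame: transport the trace along `σ`
  have hread : ∀ (Φ : CMType K) (m : Fin 3),
      (∀ a : Fin 4, e₀.symm (a, true) ∈ Φ.1 ↔ signTab 0 m (σ a) = !f m) →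
      ∀ s, s ∈ Φ.1 ↔ signTab 0 m (e s).1 = ((e s).2 != f m) := by
    intro Φ m hm
    refine mem_iff_of_reading_true he_conj fun b => ?_
    rw [hsymm, hm (σ.symm b), Equiv.apply_symm_apply]
  refine ⟨e, f, fun s => by rw [he]; exact he₀_sign s, he_conj,
    hread Φ₁ 0 fun a => by rw [← (hσ a).1, hT₀]; simp,
    hread Φ₂ 1 fun a => by rw [← (hσ a).2.1, hT₁]; simp,
    hread Φ₃ 2 fun a => by rw [← (hσ a).2.2, hT₂]; simp⟩

/-- **A conjugate reading is absorbed by the conjugate CM structure.**  If `B ⊨ (K; Φ)` via `(ι, θ)` and, in a frame `e`,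
`s ∈ Φ ⟺ [(e s).1 ∈ I_m] = ((e s).2 ≠ f)`, then `B` realises — via `(ι, θ)` itself if `f = false`, via the conjugate structure
`(ι ∘ 𝓞(c), θ ∘ c)` if `f = true` (Deligne 1982 §5 (b): `(A_Φ, ι ∘ c)` is of type `Φ̄`) — a type `Φ'` with the STRAIGHT
reading `s ∈ Φ' ⟺ (e s).2 = [(e s).1 ∈ I_m]`. [cite: Deligne1982HodgeCycles, §5 (b)] [cite: Shimura1998, §18.2] -/
theorem exists_realisation_of_reading {e : (K →+* ℂ) ≃ Fin 4 × Bool}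
    (he_conj : ∀ s, e (ComplexEmbedding.conjugate s) = ((e s).1, !(e s).2)) {m : Fin 3} {f : Bool} {Φ : CMType K}
    (hread : ∀ s, s ∈ Φ.1 ↔ signTab 0 m (e s).1 = ((e s).2 != f))
    {B : AbelianVariety ℂ} {ι : 𝓞 K →+* End B} {θ : K →+* Module.End ℂ (complexBetti B.X 1)}
    (hB : IsCMTypeRealisation Φ B ι θ) :
    ∃ (Φ' : CMType K) (ι' : 𝓞 K →+* End B) (θ' : K →+* Module.End ℂ (complexBetti B.X 1)),
      IsCMTypeRealisation Φ' B ι' θ' ∧ ∀ s, s ∈ Φ'.1 ↔ (e s).2 = signTab 0 m (e s).1 := by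
  cases f
  · refine ⟨Φ, ι, θ, hB, fun s => ?_⟩
    rw [hread]
    cases (e s).2 <;> cases signTab 0 m (e s).1 <;> decide
  · obtain ⟨Φ', hΦ'⟩ := exists_conjugate_cmType Φ
    refine ⟨Φ', _, _, hB.comp_complexConj hΦ', fun s => ?_⟩
    rw [hΦ' s, hread, he_conj]
    dsimp only
    cases (e s).2 <;> cases signTab 0 m (e s).1 <;> decide

end Frame

/-! ## §2 The intrinsic theorem (under `2`-transitivity) and the geometric theorem (`B₁` simple) -/

section Main

variable {K : Type} [Field K] [NumberField K] [IsCMField K] {k : Type} [Field k] [NumberField k] [IsCMField k] {N : ℕ}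
  {Φ₁ Φ₂ Φ₃ : CMType K} {B₁ B₂ B₃ : AbelianVariety ℂ}
  {ι₁ : 𝓞 K →+* End B₁} {θ₁ : K →+* Module.End ℂ (complexBetti B₁.X 1)}
  {ι₂ : 𝓞 K →+* End B₂} {θ₂ : K →+* Module.End ℂ (complexBetti B₂.X 1)}
  {ι₃ : 𝓞 K →+* End B₃} {θ₃ : K →+* Module.End ℂ (complexBetti B₃.X 1)}
  {Ψ : CMType k} {E : AbelianVariety ℂ} {ιE : 𝓞 k →+* End E} {θE : k →+* Module.End ℂ (complexBetti E.X 1)}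

/-- **THE HODGE CONJECTURE FOR EVERY PRODUCT OF COPIES OF `E, B₁, B₂, B₃`, GIVEN ONLY Markman's fourfold theorem** — three CM
abelian fourfolds `B_m ⊨ (K; Φ_m)` over ONE CM field `K` of degree `8` whose types have `k`-signature `(2,2)` (`h22`) and are in
general position (`h₁₂, h₁₃, h₂₃`: pairwise exactly one common member over `τ`), the CM elliptic curve `E ⊨ (k; Ψ ∋ τ)`, and
`Aut(ℂ)` `2`-TRANSITIVE on the four embeddings of `K` over `τ` (`h2T`; Dodson: automatic when one `B_m` is simple): for every
`κ : Fin N → Fin 4`, every rational `(q,q)`-class on `⨁_j ![E, B₁, B₂, B₃] (κ j)` is algebraic.  Displayed leaf: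
`Markman2025_weilClasses_algebraic_abelianFourfold` (UNREFEREED); nothing else. [cite: Markman2025SurveySecant, Thm. 1.2]
[cite: Pohlmann1968, Thm 1] [cite: Dodson1984, §3.3.2 Theorem] [cite: Deligne1982HodgeCycles, §5 (b)]
[cite: MoonenZarhin1995Duke, Thm. 2.4] -/
theorem hodgeConjectureFor_biproduct_comp_vec_of_markman₃
    (hW4 : Markman2025_weilClasses_algebraic_abelianFourfold)
    (h8 : Module.finrank ℚ K = 8) (h2 : Module.finrank ℚ k = 2) (i : k →+* K)
    (hB₁ : IsCMTypeRealisation Φ₁ B₁ ι₁ θ₁) (hB₂ : IsCMTypeRealisation Φ₂ B₂ ι₂ θ₂)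
    (hB₃ : IsCMTypeRealisation Φ₃ B₃ ι₃ θ₃) (hE : IsCMTypeRealisation Ψ E ιE θE)
    {τ : k →+* ℂ} (hτΨ : τ ∈ Ψ.1)
    (h22₁ : (Finset.univ.filter fun s : K →+* ℂ => s.comp i = τ ∧ s ∈ Φ₁.1).card = 2)
    (h22₂ : (Finset.univ.filter fun s : K →+* ℂ => s.comp i = τ ∧ s ∈ Φ₂.1).card = 2)
    (h22₃ : (Finset.univ.filter fun s : K →+* ℂ => s.comp i = τ ∧ s ∈ Φ₃.1).card = 2)
    (h₁₂ : (Finset.univ.filter fun s : K →+* ℂ => s.comp i = τ ∧ (s ∈ Φ₁.1 ∧ s ∈ Φ₂.1)).card = 1)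
    (h₁₃ : (Finset.univ.filter fun s : K →+* ℂ => s.comp i = τ ∧ (s ∈ Φ₁.1 ∧ s ∈ Φ₃.1)).card = 1)
    (h₂₃ : (Finset.univ.filter fun s : K →+* ℂ => s.comp i = τ ∧ (s ∈ Φ₂.1 ∧ s ∈ Φ₃.1)).card = 1)
    (h2T : ∀ s t s' t' : K →+* ℂ, s.comp i = τ → t.comp i = τ → s'.comp i = τ → t'.comp i = τ → s ≠ t → s' ≠ t' →
      ∃ ρ : ℂ ≃+* ℂ, (ρ : ℂ →+* ℂ).comp s = s' ∧ (ρ : ℂ →+* ℂ).comp t = t')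
    (κ : Fin N → Fin 4) :
    HodgeConjectureFor (⨁ fun j => (![E, B₁, B₂, B₃] : Fin 4 → AbelianVariety ℂ) (κ j)).dim
      (⨁ fun j => (![E, B₁, B₂, B₃] : Fin 4 → AbelianVariety ℂ) (κ j)).X := by
  have hττ : ComplexEmbedding.conjugate τ ≠ τ := QuarticCM.conjugate_ne τ
  have hk : ∀ σ : k →+* ℂ, σ = τ ∨ σ = ComplexEmbedding.conjugate τ := fun σ =>
    QuarticCM.eq_or_eq_conjugate_of_quadratic h2 τ σ
  have hΨ : ∀ σ : k →+* ℂ, σ ∈ Ψ.1 ↔ σ = τ := by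
    intro σ
    rcases hk σ with rfl | rfl
    · exact ⟨fun _ => rfl, fun _ => hτΨ⟩
    · exact ⟨fun h => absurd h ((Ψ.2 τ).1 hτΨ), fun h => absurd h hττ⟩
  -- the frame, and the straight readings after passing to conjugate structures where needed
  obtain ⟨e, f, he_sign, he_conj, hr₁, hr₂, hr₃⟩ := exists_frame₃ h8 h2 i hττ hk Φ₁ Φ₂ Φ₃ h22₁ h22₂ h22₃ h₁₂ h₁₃ h₂₃
  obtain ⟨Φ₁', ι₁', θ₁', hB₁', hΦ₁'⟩ := exists_realisation_of_reading he_conj hr₁ hB₁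
  obtain ⟨Φ₂', ι₂', θ₂', hB₂', hΦ₂'⟩ := exists_realisation_of_reading he_conj hr₂ hB₂
  obtain ⟨Φ₃', ι₃', θ₃', hB₃', hΦ₃'⟩ := exists_realisation_of_reading he_conj hr₃ hB₃
  have h2t := h2t_of_twoTransitive he_sign h2T
  -- the family `Kf = (k, K)` and the four slots `(k, K, K, K)`
  let Kf : Fin 2 → Type := Fin.cons k fun _ : Fin 1 => K
  letI instF : ∀ j, Field (Kf j) := fun j =>
    Fin.cases (motive := fun j => Field (Kf j)) ‹Field k› (fun _ => ‹Field K›) j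
  letI instN : ∀ j, NumberField (Kf j) := fun j =>
    Fin.cases (motive := fun j => NumberField (Kf j)) ‹NumberField k› (fun _ => ‹NumberField K›) j
  haveI instC : ∀ j, IsCMField (Kf j) := fun j =>
    Fin.cases (motive := fun j => IsCMField (Kf j)) ‹IsCMField k› (fun _ => ‹IsCMField K›) j
  exact hodgeConjectureFor_biproduct_comp_of_frame₃_of_markman_h2t (Kf := Kf) (i₀ := 0) (i₁ := 1)
    (A₄ := ![E, B₁, B₂, B₃])
    (Φ₄ := Fin.cons Ψ (Fin.cons Φ₁' (Fin.cons Φ₂' (Fin.cons Φ₃' finZeroElim))))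
    (ι₄ := Fin.cons ιE (Fin.cons ι₁' (Fin.cons ι₂' (Fin.cons ι₃' finZeroElim))))
    (θ₄ := Fin.cons θE (Fin.cons θ₁' (Fin.cons θ₂' (Fin.cons θ₃' finZeroElim)))) hW4 κ h8 h2 i
    (Fin.cases hE (Fin.cases hB₁' (Fin.cases hB₂' (Fin.cases hB₃' fun l => l.elim0)))) e he_sign he_conj
    (Fin.cases hΦ₁' (Fin.cases hΦ₂' (Fin.cases hΦ₃' fun l => l.elim0))) hΨ h2t

/-- **THE GEOMETRIC FORM: `B₁` SIMPLE.**  For a SIMPLE CM abelian fourfold `B₁ ⊨ (K; Φ₁)` of `k`-signature `(2,2)` — a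
DEGENERATE simple CM fourfold, of Weil type for `k`; Dodson: `Gal(Kᶜ/ℚ) ≅ ℤ₂ × A₄` or `ℤ₂ × S₄` — and any two further
realisations `B₂ ⊨ (K; Φ₂)`, `B₃ ⊨ (K; Φ₃)` of `(2,2)`-types in general position with `Φ₁` and each other (e.g. two Galois
conjugates `σB₁, σ'B₁` of other type classes): the Hodge conjecture for EVERY product of copies of `E, B₁, B₂, B₃`, GIVEN ONLY
Markman's fourfold theorem (`2`-transitivity from simplicity: gen 19's `OcticWeilFourfold.twoTransitive_of_isSimple`, Dodson
§3.3.2 + Shimura Prop. 26 BY NAME). [cite: Markman2025SurveySecant, Thm. 1.2] [cite: Dodson1984, §3.3.2 Theorem]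
[cite: Shimura1998, §8.2 Prop. 26] [cite: Pohlmann1968, Thm 1 and §3] -/
theorem hodgeConjectureFor_biproduct_comp_vec_of_isSimple_of_markman₃
    (hW4 : Markman2025_weilClasses_algebraic_abelianFourfold)
    (h8 : Module.finrank ℚ K = 8) (h2 : Module.finrank ℚ k = 2) (i : k →+* K)
    (hB₁ : IsCMTypeRealisation Φ₁ B₁ ι₁ θ₁) (hS : B₁.IsSimple) (hB₂ : IsCMTypeRealisation Φ₂ B₂ ι₂ θ₂)
    (hB₃ : IsCMTypeRealisation Φ₃ B₃ ι₃ θ₃) (hE : IsCMTypeRealisation Ψ E ιE θE)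
    {τ : k →+* ℂ} (hτΨ : τ ∈ Ψ.1)
    (h22₁ : (Finset.univ.filter fun s : K →+* ℂ => s.comp i = τ ∧ s ∈ Φ₁.1).card = 2)
    (h22₂ : (Finset.univ.filter fun s : K →+* ℂ => s.comp i = τ ∧ s ∈ Φ₂.1).card = 2)
    (h22₃ : (Finset.univ.filter fun s : K →+* ℂ => s.comp i = τ ∧ s ∈ Φ₃.1).card = 2)
    (h₁₂ : (Finset.univ.filter fun s : K →+* ℂ => s.comp i = τ ∧ (s ∈ Φ₁.1 ∧ s ∈ Φ₂.1)).card = 1)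
    (h₁₃ : (Finset.univ.filter fun s : K →+* ℂ => s.comp i = τ ∧ (s ∈ Φ₁.1 ∧ s ∈ Φ₃.1)).card = 1)
    (h₂₃ : (Finset.univ.filter fun s : K →+* ℂ => s.comp i = τ ∧ (s ∈ Φ₂.1 ∧ s ∈ Φ₃.1)).card = 1)
    (κ : Fin N → Fin 4) :
    HodgeConjectureFor (⨁ fun j => (![E, B₁, B₂, B₃] : Fin 4 → AbelianVariety ℂ) (κ j)).dim
      (⨁ fun j => (![E, B₁, B₂, B₃] : Fin 4 → AbelianVariety ℂ) (κ j)).X :=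
  hodgeConjectureFor_biproduct_comp_vec_of_markman₃ hW4 h8 h2 i hB₁ hB₂ hB₃ hE hτΨ h22₁ h22₂ h22₃ h₁₂ h₁₃ h₂₃
    (twoTransitive_of_isSimple h8 h2 i hB₁ hS τ h22₁) κ

/-- **… and for every abelian variety dominated by such a product** (isogeny factors, quotients, abelian subvarieties of some
`E^a × B₁^{n₁} × B₂^{n₂} × B₃^{n₃}` — in particular every product of Galois conjugates of the simple degenerate CM fourfold `B₁`
and of `E`, with any CM structures). [cite: Markman2025SurveySecant, Thm. 1.2] [cite: MumfordAV1970, §19] -/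
theorem hodgeConjectureFor_of_avDominatedBy_comp_vec_of_isSimple_of_markman₃
    (hW4 : Markman2025_weilClasses_algebraic_abelianFourfold)
    (h8 : Module.finrank ℚ K = 8) (h2 : Module.finrank ℚ k = 2) (i : k →+* K)
    (hB₁ : IsCMTypeRealisation Φ₁ B₁ ι₁ θ₁) (hS : B₁.IsSimple) (hB₂ : IsCMTypeRealisation Φ₂ B₂ ι₂ θ₂)
    (hB₃ : IsCMTypeRealisation Φ₃ B₃ ι₃ θ₃) (hE : IsCMTypeRealisation Ψ E ιE θE)
    {τ : k →+* ℂ} (hτΨ : τ ∈ Ψ.1)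
    (h22₁ : (Finset.univ.filter fun s : K →+* ℂ => s.comp i = τ ∧ s ∈ Φ₁.1).card = 2)
    (h22₂ : (Finset.univ.filter fun s : K →+* ℂ => s.comp i = τ ∧ s ∈ Φ₂.1).card = 2)
    (h22₃ : (Finset.univ.filter fun s : K →+* ℂ => s.comp i = τ ∧ s ∈ Φ₃.1).card = 2)
    (h₁₂ : (Finset.univ.filter fun s : K →+* ℂ => s.comp i = τ ∧ (s ∈ Φ₁.1 ∧ s ∈ Φ₂.1)).card = 1)
    (h₁₃ : (Finset.univ.filter fun s : K →+* ℂ => s.comp i = τ ∧ (s ∈ Φ₁.1 ∧ s ∈ Φ₃.1)).card = 1)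
    (h₂₃ : (Finset.univ.filter fun s : K →+* ℂ => s.comp i = τ ∧ (s ∈ Φ₂.1 ∧ s ∈ Φ₃.1)).card = 1)
    (κ : Fin N → Fin 4) {C : AbelianVariety ℂ}
    (hC : Domination.AVDominatedBy C (⨁ fun j => (![E, B₁, B₂, B₃] : Fin 4 → AbelianVariety ℂ) (κ j))) :
    HodgeConjectureFor C.dim C.X :=
  Domination.hodgeConjectureFor_of_avDominatedBy
    (hodgeConjectureFor_biproduct_comp_vec_of_isSimple_of_markman₃ hW4 h8 h2 i hB₁ hS hB₂ hB₃ hE hτΨ h22₁ h22₂ h22₃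
      h₁₂ h₁₃ h₂₃ κ) hC

end Main

end Summit.HodgeConjecture.CorCM.OcticWeilOrbit

end
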